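import Summits.Ventures.LatticeQCDFlow.Scaling.FlowHubSchemeFloor
import Summits.Ventures.LatticeQCDFlow.Scaling.ReplicaExchangeFlowSwap
import Summits.Ventures.LatticeQCDFlow.Scaling.ReplicaExchangeFrozenColdDirect

/-!
HONEST FRAMING: exact (Metropolis-corrected) sampling algorithms for lattice gauge theory; figures
of merit are autocorrelation/cost numbers at stated couplings and volumes; no continuum-physics
claim.

# FlowLadderConjugacy — EVERY MAP-ASSISTED LADDER IS A PLAIN LADDER IN LEVEL COORDINATES: WITH LEVEL BIJECTIONS `L_i`
# AND THE ADJACENT MAPS `φ_j = L_{j+1}⁻¹∘L_j`, `ptFlowSampler t μ M φ (x,y) = ptBareSampler t ν M^L (Lx, Ly)` FOR THE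
# PULLED-BACK LAWS `ν_i = μ_i∘L_i⁻¹`, SO `Gap(ptFlowSampler) = Gap(ptBareSampler for ν)`; ADJACENT MAPS THAT TRANSPORT EACH
# LEVEL ONTO THE NEXT MAKE ANY LADDER RELAX LIKE THE IDENTICAL-LEVEL LADDER:
# `Gap ≥ min{t/(6K²(K+1)), γ₀(1−t)/(6(K+1)²)}` WHATEVER THE COLD LAWS (lean-2 GEN-21, ours)

Venture-side (OURS).  Cell `lqcd-flow` (pub-lqcd), unit `pub-lqcd-lean-2-g21`, 2026-08-26.  Chapter I, third file.  The
flow-assisted ladder `ptFlowSampler t μ M φ` of `Scaling/ReplicaExchangeFlowSwap` (F1: a uniformly chosen adjacent pair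
`(j, j+1)` exchanges through the bijection `φ_j`, Metropolis-corrected; with probability `1 − t` a uniform replica is
updated) and the plain ladder `ptBareSampler` of `Scaling/ReplicaExchangeBareSampler`.  Every family of adjacent maps
`φ` is of the form `φ_j = L_{j+1}⁻¹∘L_j` for level bijections `L_0 = 1`, `L_{j+1} = L_j∘φ_j⁻¹` (`exists_levelMaps`),
and in the LEVEL COORDINATES `x ↦ (L_i x_i)_i` the flow swap at `(j, j+1)` is the plain transposition
(`ladderRelabel_flowSwapAt`).  With the relabelling lemmas of `Scaling/FlowHubSchemeFloor` (`spectralGap_conj`,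
`mhKernel_conj`, `prodKernel_conj`) the whole sampler is conjugate to the plain ladder for the pulled-back laws
`ν_i = μ_i∘L_i⁻¹` and the conjugated updates, and every spectral statement about plain ladders becomes a statement about
flow ladders with OVERLAPS OF THE PULLED-BACK LAWS — i.e. transport quality along the composed maps — in place of raw
overlaps.  Transferred here: the direct floor of `Scaling/ReplicaExchangeFrozenColdDirect` (R6b).

## What is proved

* §1 `tensorFun_relabel`, **`ladderRelabel_flowSwapAt`**, `ptFlowProposal_ladderRelabel`, **`ptFlowSampler_eq_conj`**
  (`ptFlowSampler t μ M φ^L (x,y) = ptBareSampler t ν^L M^L (Lx, Ly)`), **`ptFlowSampler_spectralGap_eq_conj`**;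
  `exists_levelMaps` (every `φ` is some `φ^L` with `L_0 = 1`).
* §2 **`flowLadder_spectralGap_ge_of_cooling`** — R6b in level coordinates: transport persistence `p`
  (`p·ν_k ≤ ν_i`, `i ≤ k`) and one-level transport cooling `q` (`q·ν_l ≤ ν_{l+1}`) give
  `Gap(ptFlowSampler t μ M φ^L) ≥ min{p q^K t/(6K²(K+1)), p q^K γ₀(1−t)/(6(K+1)²)}` with ARBITRARY `μ_k`-reversible cold
  updates; **`flowLadderPerfect_spectralGap_ge`** (`ν_i = μ_0` for all `i`) and its `φ`-form
  **`flowLadderPerfect_spectralGap_ge_of_adjacent`**: if every `φ_j` transports level `j` onto level `j+1`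
  (`μ_{j+1}(φ_j u) = μ_j(u)`), then `Gap(ptFlowSampler t μ M φ) ≥ min{t/(6K²(K+1)), γ₀(1−t)/(6(K+1)²)}` for EVERY family
  of cold laws — the identical-level floor of R6b §3, against the order-`K⁻³` ceiling of
  `Scaling/ReplicaExchangeFlowSwapDiffusive` for sector-preserving maps: `Θ(K³)`.

Reading (no numerics implied): on a ladder, learned adjacent maps can remove the overlap penalty completely (perfect
transports make the coupling gaps invisible to the sampler) and change nothing else: the relaxation over `K`
sector-frozen cold replicas stays cubic in `K`.  NOT CLAIMED: continuous configuration spaces (Jacobians); non-bijective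
or stochastic maps; anything measured.  Literature grade (cell rule): OWN MECHANISM, NEW TYPING; nothing cited as a
fact; no new bib keys.
-/

noncomputable section

open Finset Function
open Literature.Probability.MarkovChains

namespace Summit.Ventures.LatticeQCDFlow.Scaling

variable {S : Type*} [Fintype S] [DecidableEq S] {K : ℕ} {μ : Fin (K + 1) → S → ℝ}
  {M : Fin (K + 1) → S → S → ℝ} {t : ℝ}

/-! ## §1 Level coordinates -/

section Conj
variable (L : Fin (K + 1) → Equiv.Perm S)

omit [Fintype S] [DecidableEq S] in
/-- The product law in level coordinates: `π̃_μ(x) = ν̃(Lx)` with `ν_i = μ_i∘L_i⁻¹`. [ours] -/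
theorem tensorFun_relabel (μ : Fin (K + 1) → S → ℝ) (x : Fin (K + 1) → S) :
    tensorFun μ x = tensorFun (fun i u => μ i ((L i).symm u)) (fun i => L i (x i)) := by
  unfold tensorFun
  simp only [Equiv.symm_apply_apply]

omit [Fintype S] [DecidableEq S] in
/-- **In level coordinates the flow swap at `(j, j+1)` through `φ_j = L_{j+1}⁻¹∘L_j` is the plain transposition:**
`L(flowSwapAt φ j x) = (Lx)∘σ_j`. [ours] -/
theorem ladderRelabel_flowSwapAt (x : Fin (K + 1) → S) (j : Fin K) :
    (fun i => L i (flowSwapAt (fun j : Fin K => (L j.castSucc).trans (L j.succ).symm) j x i))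
      = (fun i => L i (x i)) ∘ levelSwap j := by
  have hne : j.castSucc ≠ j.succ := fun h => (Fin.castSucc_lt_succ (i := j)).ne h
  funext i
  simp only [Function.comp_apply, levelSwap]
  by_cases h1 : i = j.castSucc
  · subst h1
    rw [Equiv.swap_apply_left, flowSwapAt_castSucc]
    simp
  · by_cases h2 : i = j.succ
    · subst h2
      rw [Equiv.swap_apply_right, flowSwapAt_succ]
      simp
    · rw [Equiv.swap_apply_of_ne_of_ne h1 h2, flowSwapAt_of_ne _ _ _ h1 h2]

omit [Fintype S] in
/-- The flow-swap proposal in level coordinates is the plain swap proposal. [ours] -/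
theorem ptFlowProposal_ladderRelabel (x y : Fin (K + 1) → S) :
    ptFlowProposal (fun j : Fin K => (L j.castSucc).trans (L j.succ).symm) x y
      = ptBareProposal (fun i => L i (x i)) (fun i => L i (y i)) := by
  unfold ptFlowProposal ptBareProposal
  refine sum_congr rfl fun j _ => if_congr ?_ rfl rfl
  have hinj : Function.Injective (fun (z : Fin (K + 1) → S) (i : Fin (K + 1)) => L i (z i)) :=
    fun z z' h => funext fun i => (L i).injective (congrFun h i)
  rw [← ladderRelabel_flowSwapAt L x j]
  exact ⟨fun h => by rw [h], fun h => hinj h⟩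

/-- **THE CONJUGACY:** `ptFlowSampler t μ M φ^L (x,y) = ptBareSampler t ν^L M^L (Lx, Ly)` with `ν^L_i = μ_i∘L_i⁻¹`,
`M^L_i(u,v) = M_i(L_i⁻¹u, L_i⁻¹v)`. [ours] -/
theorem ptFlowSampler_eq_conj (t : ℝ) (μ : Fin (K + 1) → S → ℝ) (M : Fin (K + 1) → S → S → ℝ) (x y : Fin (K + 1) → S) :
    ptFlowSampler t μ M (fun j : Fin K => (L j.castSucc).trans (L j.succ).symm) x y
      = ptBareSampler t (fun i u => μ i ((L i).symm u)) (fun i u v => M i ((L i).symm u) ((L i).symm v))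
          (fun i => L i (x i)) (fun i => L i (y i)) := by
  rw [ptFlowSampler_apply, ptBareSampler_apply]
  congr 2
  · unfold ptFlowSwap ptBareSwap
    exact mhKernel_conj (Equiv.piCongrRight L) (T' := ptBareProposal)
      (π' := tensorFun (fun i u => μ i ((L i).symm u)))
      (fun a b => ptFlowProposal_ladderRelabel L a b) (fun a => tensorFun_relabel L μ a) x y
  · exact prodKernel_conj L _ M x y

/-- **THE SPECTRAL GAP OF A FLOW LADDER IS THAT OF THE CONJUGATE PLAIN LADDER:**
`Gap_π̃(ptFlowSampler t μ M φ^L) = Gap_ν̃(ptBareSampler t ν^L M^L)`. [ours] -/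
theorem ptFlowSampler_spectralGap_eq_conj (t : ℝ) (μ : Fin (K + 1) → S → ℝ) (M : Fin (K + 1) → S → S → ℝ) :
    spectralGap (tensorFun μ) (ptFlowSampler t μ M (fun j : Fin K => (L j.castSucc).trans (L j.succ).symm))
      = spectralGap (tensorFun (fun i u => μ i ((L i).symm u)))
          (ptBareSampler t (fun i u => μ i ((L i).symm u)) (fun i u v => M i ((L i).symm u) ((L i).symm v))) := by
  refine Eq.trans ?_ (spectralGap_conj (Equiv.piCongrRight L) _ _)
  congr 1
  · funext x; exact tensorFun_relabel L μ x
  · funext x y; exact ptFlowSampler_eq_conj L t μ M x y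

end Conj

omit [Fintype S] [DecidableEq S] in
/-- **Every family of adjacent maps has level coordinates:** `L_0 = 1`, `L_{j+1} = L_j∘φ_j⁻¹`, and then
`φ_j = L_{j+1}⁻¹∘L_j`. [ours] -/
theorem exists_levelMaps (φ : Fin K → Equiv.Perm S) :
    ∃ L : Fin (K + 1) → Equiv.Perm S, L 0 = Equiv.refl S ∧ ∀ j : Fin K, (L j.castSucc).trans (L j.succ).symm = φ j := by
  refine ⟨Fin.induction (motive := fun _ => Equiv.Perm S) (Equiv.refl S) (fun j Lj => (φ j).symm.trans Lj),
    Fin.induction_zero _ _, fun j => ?_⟩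
  ext u
  simp only [Fin.induction_succ, Equiv.trans_apply, Equiv.symm_trans_apply, Equiv.symm_symm, Equiv.symm_apply_apply]

/-! ## §2 The direct floor in level coordinates; perfect transports -/

section Floors
variable (L : Fin (K + 1) → Equiv.Perm S)

/-- **THE DIRECT FLOOR FOR A FLOW LADDER (R6b in level coordinates):** with `ν_i = μ_i∘L_i⁻¹` (`L_0 = 1`), transport
persistence `p·ν_k(u) ≤ ν_i(u)` (`i ≤ k`), one-level transport cooling `q·ν_l(u) ≤ ν_{l+1}(u)` (`0 < q ≤ 1`), hot
Poincaré constant `γ₀`, ARBITRARY `μ_k`-reversible cold updates (`K ≥ 1`, `0 < t < 1`, `|S| ≥ 2`):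
`Gap(ptFlowSampler t μ M φ^L) ≥ min{p q^K t/(6K²(K+1)), p q^K γ₀(1−t)/(6(K+1)²)}`. [ours] -/
theorem flowLadder_spectralGap_ge_of_cooling [Nontrivial S] (hL0 : L 0 = Equiv.refl S) (hK : 1 ≤ K)
    (hμ : ∀ k x, 0 < μ k x) (hμ1 : ∀ k, ∑ u, μ k u = 1) (hM : ∀ k, IsRowStochastic (M k))
    (hMrev : ∀ k, DetailedBalance (μ k) (M k)) (ht0 : 0 < t) (ht1 : t < 1) {p q γ₀ : ℝ} (hp : 0 < p) (hq0 : 0 < q)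
    (hq1 : q ≤ 1) (hγ₀ : 0 < γ₀)
    (hpers : ∀ (i k : Fin (K + 1)) (u : S), i ≤ k → p * μ k ((L k).symm u) ≤ μ i ((L i).symm u))
    (hq : ∀ (l : Fin K) (u : S), q * μ l.castSucc ((L l.castSucc).symm u) ≤ μ l.succ ((L l.succ).symm u))
    (hgap0 : ∀ h : S → ℝ, γ₀ * lawVariance (μ 0) h ≤ dirichletForm (μ 0) (M 0) h) :
    min (p * q ^ K * t / (6 * K ^ 2 * (K + 1))) (p * q ^ K * γ₀ * (1 - t) / (6 * (K + 1) ^ 2))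
      ≤ spectralGap (tensorFun μ) (ptFlowSampler t μ M (fun j : Fin K => (L j.castSucc).trans (L j.succ).symm)) := by
  rw [ptFlowSampler_spectralGap_eq_conj L t μ M]
  have hL0u : ∀ u, (L 0).symm u = u := fun u => by rw [hL0]; rfl
  have hν0 : (fun u => μ 0 ((L 0).symm u)) = μ 0 := funext fun u => by rw [hL0u]
  have hM0 : (fun u v => M 0 ((L 0).symm u) ((L 0).symm v)) = M 0 := funext fun u => funext fun v => by rw [hL0u, hL0u]
  refine ptBareDirect_spectralGap_ge_of_cooling (μ := fun i u => μ i ((L i).symm u))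
    (M := fun i u v => M i ((L i).symm u) ((L i).symm v)) hK (fun k u => hμ k _)
    (fun k => by rw [Equiv.sum_comp (L k).symm (μ k)]; exact hμ1 k) (fun k => ⟨fun u v => (hM k).1 _ _, fun u => ?_⟩)
    (fun k u v => hMrev k _ _) ht0 ht1 hp hq0 hq1 hγ₀ (fun i k u hik => hpers i k u hik) (fun l u => hq l u) ?_
  · simpa using (Equiv.sum_comp (L k).symm (fun v => M k ((L k).symm u) v)).trans ((hM k).2 _)
  · intro h
    have e1 : lawVariance (fun u => μ 0 ((L 0).symm u)) h = lawVariance (μ 0) h := by rw [hν0]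
    have e2 : dirichletForm (fun u => μ 0 ((L 0).symm u)) (fun u v => M 0 ((L 0).symm u) ((L 0).symm v)) h
        = dirichletForm (μ 0) (M 0) h := by rw [hν0, hM0]
    rw [e1, e2]; exact hgap0 h

/-- **PERFECT COMPOSED TRANSPORTS: `Gap(ptFlowSampler t μ M φ^L) ≥ min{t/(6K²(K+1)), γ₀(1−t)/(6(K+1)²)}`** whenever
`μ_i∘L_i⁻¹ = μ_0` for every level (`L_0 = 1`) — the identical-level floor of R6b §3, for ARBITRARY cold laws and
ARBITRARY `μ_k`-reversible cold updates. [ours] -/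
theorem flowLadderPerfect_spectralGap_ge [Nontrivial S] (hL0 : L 0 = Equiv.refl S) (hK : 1 ≤ K)
    (hμ : ∀ k x, 0 < μ k x) (hμ1 : ∀ k, ∑ u, μ k u = 1) (hM : ∀ k, IsRowStochastic (M k))
    (hMrev : ∀ k, DetailedBalance (μ k) (M k)) (ht0 : 0 < t) (ht1 : t < 1)
    (hperf : ∀ (i : Fin (K + 1)) (u : S), μ i ((L i).symm u) = μ 0 u) {γ₀ : ℝ} (hγ₀ : 0 < γ₀)
    (hgap0 : ∀ h : S → ℝ, γ₀ * lawVariance (μ 0) h ≤ dirichletForm (μ 0) (M 0) h) :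
    min (t / (6 * K ^ 2 * (K + 1))) (γ₀ * (1 - t) / (6 * (K + 1) ^ 2))
      ≤ spectralGap (tensorFun μ) (ptFlowSampler t μ M (fun j : Fin K => (L j.castSucc).trans (L j.succ).symm)) := by
  have h := flowLadder_spectralGap_ge_of_cooling L (p := 1) (q := 1) hL0 hK hμ hμ1 hM hMrev ht0 ht1 one_pos one_pos
    le_rfl hγ₀ (fun i k u _ => by rw [hperf k, hperf i, one_mul]) (fun l u => by rw [hperf, hperf, one_mul]) hgap0
  simpa using h

end Floors

/-- **ADJACENT MAPS THAT TRANSPORT EACH LEVEL ONTO THE NEXT MAKE ANY LADDER RELAX LIKE THE IDENTICAL-LEVEL LADDER:**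
if `μ_{j+1}(φ_j u) = μ_j(u)` for all `j`, `u`, then
`Gap(ptFlowSampler t μ M φ) ≥ min{t/(6K²(K+1)), γ₀(1−t)/(6(K+1)²)}` — for every family of cold laws and every family of
`μ_k`-reversible cold updates (`K ≥ 1`, `0 < t < 1`, `|S| ≥ 2`, hot Poincaré constant `γ₀`). [ours] -/
theorem flowLadderPerfect_spectralGap_ge_of_adjacent [Nontrivial S] (φ : Fin K → Equiv.Perm S) (hK : 1 ≤ K)
    (hμ : ∀ k x, 0 < μ k x) (hμ1 : ∀ k, ∑ u, μ k u = 1) (hM : ∀ k, IsRowStochastic (M k))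
    (hMrev : ∀ k, DetailedBalance (μ k) (M k)) (ht0 : 0 < t) (ht1 : t < 1)
    (hperfect : ∀ (j : Fin K) (u : S), μ j.succ (φ j u) = μ j.castSucc u) {γ₀ : ℝ} (hγ₀ : 0 < γ₀)
    (hgap0 : ∀ h : S → ℝ, γ₀ * lawVariance (μ 0) h ≤ dirichletForm (μ 0) (M 0) h) :
    min (t / (6 * K ^ 2 * (K + 1))) (γ₀ * (1 - t) / (6 * (K + 1) ^ 2))
      ≤ spectralGap (tensorFun μ) (ptFlowSampler t μ M φ) := by
  obtain ⟨L, hL0, hLφ⟩ := exists_levelMaps φ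
  have hφ : φ = fun j : Fin K => (L j.castSucc).trans (L j.succ).symm := (funext hLφ).symm
  -- the pulled-back laws are all `μ_0`, by induction up the ladder
  have hstep : ∀ (j : Fin K) (u : S), (L j.succ).symm u = φ j ((L j.castSucc).symm u) := by
    intro j u
    have h := Equiv.ext_iff.mp (hLφ j) ((L j.castSucc).symm u)
    simp only [Equiv.trans_apply, Equiv.apply_symm_apply] at h
    exact h
  have hperf : ∀ (i : Fin (K + 1)) (u : S), μ i ((L i).symm u) = μ 0 u := by
    intro i
    induction i using Fin.induction with
    | zero => intro u; rw [hL0]; rfl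
    | succ j ih => intro u; rw [hstep j u, hperfect j, ih]
  rw [hφ]
  exact flowLadderPerfect_spectralGap_ge L hL0 hK hμ hμ1 hM hMrev ht0 ht1 hperf hγ₀ hgap0

end Summit.Ventures.LatticeQCDFlow.Scaling

end
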